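import Mathlib
import Summits.Ventures.PercRepro.TriangleCapThreeBelowThreeTrianglesNineA
import Summits.Ventures.PercRepro.TriangleCapThreeBelowThreeTrianglesNineB
import Summits.Ventures.PercRepro.TriangleCapThreeBelowThreeTrianglesF

/-!
# PercRepro — THREE BELOW THE DIAGONAL, THREE TRIANGLES AT `(9, 15)`, PART C: THE STABILITY AND THE DISPATCH
(p3, gen 38; part 118)

The configuration counts of parts A–B (and the windmill of part 102, valid from `k = 8`) with `|T₃| ≤ 18`:
`three_triangles_stability_three_of_disjoint_nine` / `_of_one_shared_nine` / `_of_path_nine`, and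
**`three_triangles_stability_three_nine`**: `K₄⁻`-free on `9` vertices with `15` edges, three triangles carrying
every triangle ⇒ `Σ_v d(v)² + 15 ≤ 135`, by the eight intersection patterns as in part 103.  Axioms: standard.
-/

namespace PercRepro

namespace TriangleCap

namespace C047

open Finset

variable {V : Type*} [Fintype V] [DecidableEq V]

/-- **`r = 3`, THREE VERTEX-DISJOINT TRIANGLES, `k ≥ 9`, `m ≤ 16`.** -/
theorem three_triangles_stability_three_of_disjoint_nine (D : SimpleGraph V) [DecidableRel D.Adj] (hK : K4mFree D)
    (hk : 9 ≤ Fintype.card V) (hm : D.edgeFinset.card ≤ 16) (T₁ T₂ T₃ : Finset V) (h₁ : T₁.card = 3)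
    (h₂ : T₂.card = 3) (h₃ : T₃.card = 3) (h12 : Disjoint T₁ T₂) (h13 : Disjoint T₁ T₃) (h23 : Disjoint T₂ T₃)
    (hcl₁ : ∀ x ∈ T₁, ∀ y ∈ T₁, x ≠ y → D.Adj x y) (hcl₂ : ∀ x ∈ T₂, ∀ y ∈ T₂, x ≠ y → D.Adj x y)
    (hcl₃ : ∀ x ∈ T₃, ∀ y ∈ T₃, x ≠ y → D.Adj x y)
    (hone₁ : ∀ z, z ∉ T₁ → degIn D T₁ z ≤ 1) (hone₂ : ∀ z, z ∉ T₂ → degIn D T₂ z ≤ 1)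
    (hone₃ : ∀ z, z ∉ T₃ → degIn D T₃ z ≤ 1)
    (hT : ∀ x y z, D.Adj x y → D.Adj x z → D.Adj y z →
      (x ∈ T₁ ∧ y ∈ T₁) ∨ (x ∈ T₂ ∧ y ∈ T₂) ∨ (x ∈ T₃ ∧ y ∈ T₃)) :
    ∑ v, deg D v * deg D v + 3 * (Fintype.card V - 4) ≤ D.edgeFinset.card * Fintype.card V := by
  have hdef := six_mul_card_le_sum_deficit_add_six_of_three_disjoint_nine D T₁ T₂ T₃ h₁ h₂ h₃ h12 h13 h23
    hcl₁ hcl₂ hcl₃ hone₁ hone₂ hone₃ hk hm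
  have h18 := card_triangles3_le_eighteen_of_three D T₁ T₂ T₃ h₁ h₂ h₃ hcl₁ hcl₂ hcl₃ hT
    (fun x y z z' hxy hxz hyz hxz' hyz' => eq_of_common_nbr D hK hxy hxz hyz hxz' hyz')
  have hid := two_mul_sum_deg_sq_add_sum_deficit D
  have hmk : 2 * (D.edgeFinset.card * Fintype.card V) = 2 * D.edgeFinset.card * Fintype.card V := by ring
  omega

/-- **`r = 3`, THREE TRIANGLES WITH ONE SHARED VERTEX AT `(9, 15)`.** -/
theorem three_triangles_stability_three_of_one_shared_nine (D : SimpleGraph V) [DecidableRel D.Adj]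
    (hK : K4mFree D) (hk : Fintype.card V = 9) (hm : D.edgeFinset.card = 15) (T₁ T₂ T₃ : Finset V)
    (h₁ : T₁.card = 3) (h₂ : T₂.card = 3) (h₃ : T₃.card = 3) {t : V} (hint : T₁ ∩ T₂ = {t})
    (h13 : Disjoint T₁ T₃) (h23 : Disjoint T₂ T₃)
    (hcl₁ : ∀ x ∈ T₁, ∀ y ∈ T₁, x ≠ y → D.Adj x y) (hcl₂ : ∀ x ∈ T₂, ∀ y ∈ T₂, x ≠ y → D.Adj x y)
    (hcl₃ : ∀ x ∈ T₃, ∀ y ∈ T₃, x ≠ y → D.Adj x y)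
    (hone₁ : ∀ z, z ∉ T₁ → degIn D T₁ z ≤ 1) (hone₂ : ∀ z, z ∉ T₂ → degIn D T₂ z ≤ 1)
    (hone₃ : ∀ z, z ∉ T₃ → degIn D T₃ z ≤ 1)
    (hT : ∀ x y z, D.Adj x y → D.Adj x z → D.Adj y z →
      (x ∈ T₁ ∧ y ∈ T₁) ∨ (x ∈ T₂ ∧ y ∈ T₂) ∨ (x ∈ T₃ ∧ y ∈ T₃)) :
    ∑ v, deg D v * deg D v + 3 * (Fintype.card V - 4) ≤ D.edgeFinset.card * Fintype.card V := by
  have hdef := six_mul_card_le_sum_deficit_add_six_of_one_shared_nine D T₁ T₂ T₃ h₁ h₂ h₃ hint h13 h23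
    hcl₁ hcl₂ hcl₃ hone₁ hone₂ hone₃ hk hm
  have h18 := card_triangles3_le_eighteen_of_three D T₁ T₂ T₃ h₁ h₂ h₃ hcl₁ hcl₂ hcl₃ hT
    (fun x y z z' hxy hxz hyz hxz' hyz' => eq_of_common_nbr D hK hxy hxz hyz hxz' hyz')
  have hid := two_mul_sum_deg_sq_add_sum_deficit D
  have hmk : 2 * (D.edgeFinset.card * Fintype.card V) = 2 * D.edgeFinset.card * Fintype.card V := by ring
  omega

/-- **`r = 3`, A PATH OF THREE TRIANGLES AT `(9, 15)`.** -/
theorem three_triangles_stability_three_of_path_nine (D : SimpleGraph V) [DecidableRel D.Adj] (hK : K4mFree D)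
    (hk : Fintype.card V = 9) (hm : D.edgeFinset.card = 15) (T₁ T₂ T₃ : Finset V) (h₁ : T₁.card = 3)
    (h₂ : T₂.card = 3) (h₃ : T₃.card = 3) {t t' : V} (hint : T₁ ∩ T₂ = {t}) (hint' : T₂ ∩ T₃ = {t'})
    (h13 : Disjoint T₁ T₃)
    (hcl₁ : ∀ x ∈ T₁, ∀ y ∈ T₁, x ≠ y → D.Adj x y) (hcl₂ : ∀ x ∈ T₂, ∀ y ∈ T₂, x ≠ y → D.Adj x y)
    (hcl₃ : ∀ x ∈ T₃, ∀ y ∈ T₃, x ≠ y → D.Adj x y)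
    (hone₁ : ∀ z, z ∉ T₁ → degIn D T₁ z ≤ 1) (hone₂ : ∀ z, z ∉ T₂ → degIn D T₂ z ≤ 1)
    (hone₃ : ∀ z, z ∉ T₃ → degIn D T₃ z ≤ 1)
    (hT : ∀ x y z, D.Adj x y → D.Adj x z → D.Adj y z →
      (x ∈ T₁ ∧ y ∈ T₁) ∨ (x ∈ T₂ ∧ y ∈ T₂) ∨ (x ∈ T₃ ∧ y ∈ T₃)) :
    ∑ v, deg D v * deg D v + 3 * (Fintype.card V - 4) ≤ D.edgeFinset.card * Fintype.card V := by
  have hdef := six_mul_card_le_sum_deficit_add_six_of_path_nine D T₁ T₂ T₃ h₁ h₂ h₃ hint hint' h13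
    hcl₁ hcl₂ hcl₃ hone₁ hone₂ hone₃ hk hm
  have h18 := card_triangles3_le_eighteen_of_three D T₁ T₂ T₃ h₁ h₂ h₃ hcl₁ hcl₂ hcl₃ hT
    (fun x y z z' hxy hxz hyz hxz' hyz' => eq_of_common_nbr D hK hxy hxz hyz hxz' hyz')
  have hid := two_mul_sum_deg_sq_add_sum_deficit D
  have hmk : 2 * (D.edgeFinset.card * Fintype.card V) = 2 * D.edgeFinset.card * Fintype.card V := by ring
  omega

/-- **THREE BELOW THE DIAGONAL, THREE TRIANGLES CARRYING EVERY TRIANGLE, AT `(9, 15)`.** -/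
theorem three_triangles_stability_three_nine (D : SimpleGraph V) [DecidableRel D.Adj] (hK : K4mFree D)
    (hk : Fintype.card V = 9) (hm : D.edgeFinset.card = 15) {u v w a b c x y z : V}
    (huv : D.Adj u v) (huw : D.Adj u w) (hvw : D.Adj v w) (hab : D.Adj a b) (hac : D.Adj a c) (hbc : D.Adj b c)
    (hxy : D.Adj x y) (hxz : D.Adj x z) (hyz : D.Adj y z)
    (ha : ¬ (a = u ∨ a = v ∨ a = w)) (hx : ¬ (x = u ∨ x = v ∨ x = w ∨ x = a ∨ x = b ∨ x = c))
    (hT : ∀ x' y' z', D.Adj x' y' → D.Adj x' z' → D.Adj y' z' →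
      (x' ∈ ({u, v, w} : Finset V) ∧ y' ∈ ({u, v, w} : Finset V)) ∨
      (x' ∈ ({a, b, c} : Finset V) ∧ y' ∈ ({a, b, c} : Finset V)) ∨
      (x' ∈ ({x, y, z} : Finset V) ∧ y' ∈ ({x, y, z} : Finset V))) :
    ∑ v, deg D v * deg D v + 3 * (Fintype.card V - 4) ≤ D.edgeFinset.card * Fintype.card V := by
  have hm' : 6 * Fintype.card V ≤ 2 * D.edgeFinset.card + 24 := by omega
  set T₁ : Finset V := {u, v, w} with hT₁
  set T₂ : Finset V := {a, b, c} with hT₂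
  set T₃ : Finset V := {x, y, z} with hT₃
  have h₁ : T₁.card = 3 := card_triple huv.ne huw.ne hvw.ne
  have h₂ : T₂.card = 3 := card_triple hab.ne hac.ne hbc.ne
  have h₃ : T₃.card = 3 := card_triple hxy.ne hxz.ne hyz.ne
  have hcl₁ := clique_triple D huv huw hvw
  have hcl₂ := clique_triple D hab hac hbc
  have hcl₃ := clique_triple D hxy hxz hyz
  have hone₁ : ∀ z', z' ∉ T₁ → degIn D T₁ z' ≤ 1 := fun z' hz => degIn_le_one_of_triangle D hK huv huw hvw hz
  have hone₂ : ∀ z', z' ∉ T₂ → degIn D T₂ z' ≤ 1 := fun z' hz => degIn_le_one_of_triangle D hK hab hac hbc hz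
  have hone₃ : ∀ z', z' ∉ T₃ → degIn D T₃ z' ≤ 1 := fun z' hz => degIn_le_one_of_triangle D hK hxy hxz hyz hz
  have hx1 : ¬ (x = u ∨ x = v ∨ x = w) := fun h => hx (by tauto)
  have hx2 : ¬ (x = a ∨ x = b ∨ x = c) := fun h => hx (by tauto)
  have hi12 : (T₁ ∩ T₂).card ≤ 1 := inter_card_le_one_of_triangles D hK huv huw hvw hab hac hbc ha
  have hi13 : (T₁ ∩ T₃).card ≤ 1 := inter_card_le_one_of_triangles D hK huv huw hvw hxy hxz hyz hx1
  have hi23 : (T₂ ∩ T₃).card ≤ 1 := inter_card_le_one_of_triangles D hK hab hac hbc hxy hxz hyz hx2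
  rcases eq_empty_or_singleton_of_card_le_one hi12 with e12 | ⟨t, e12⟩ <;>
    rcases eq_empty_or_singleton_of_card_le_one hi13 with e13 | ⟨t', e13⟩ <;>
    rcases eq_empty_or_singleton_of_card_le_one hi23 with e23 | ⟨t'', e23⟩
  · exact three_triangles_stability_three_of_disjoint_nine D hK (by omega) (by omega) T₁ T₂ T₃ h₁ h₂ h₃
      (disjoint_iff_inter_eq_empty.mpr e12) (disjoint_iff_inter_eq_empty.mpr e13)
      (disjoint_iff_inter_eq_empty.mpr e23) hcl₁ hcl₂ hcl₃ hone₁ hone₂ hone₃ hT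
  · exact three_triangles_stability_three_of_one_shared_nine D hK hk hm T₂ T₃ T₁ h₂ h₃ h₁ e23
      (disjoint_iff_inter_eq_empty.mpr (by rw [inter_comm]; exact e12))
      (disjoint_iff_inter_eq_empty.mpr (by rw [inter_comm]; exact e13)) hcl₂ hcl₃ hcl₁ hone₂ hone₃ hone₁
      (fun x' y' z' h1 h2 h3 => by
        rcases hT x' y' z' h1 h2 h3 with h | h | h
        · exact Or.inr (Or.inr h)
        · exact Or.inl h
        · exact Or.inr (Or.inl h))
  · exact three_triangles_stability_three_of_one_shared_nine D hK hk hm T₁ T₃ T₂ h₁ h₃ h₂ e13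
      (disjoint_iff_inter_eq_empty.mpr e12)
      (disjoint_iff_inter_eq_empty.mpr (by rw [inter_comm]; exact e23)) hcl₁ hcl₃ hcl₂ hone₁ hone₃ hone₂
      (fun x' y' z' h1 h2 h3 => by
        rcases hT x' y' z' h1 h2 h3 with h | h | h
        · exact Or.inl h
        · exact Or.inr (Or.inr h)
        · exact Or.inr (Or.inl h))
  · exact three_triangles_stability_three_of_path_nine D hK hk hm T₁ T₃ T₂ h₁ h₃ h₂ e13
      (by rw [inter_comm]; exact e23) (disjoint_iff_inter_eq_empty.mpr e12) hcl₁ hcl₃ hcl₂ hone₁ hone₃ hone₂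
      (fun x' y' z' h1 h2 h3 => by
        rcases hT x' y' z' h1 h2 h3 with h | h | h
        · exact Or.inl h
        · exact Or.inr (Or.inr h)
        · exact Or.inr (Or.inl h))
  · exact three_triangles_stability_three_of_one_shared_nine D hK hk hm T₁ T₂ T₃ h₁ h₂ h₃ e12
      (disjoint_iff_inter_eq_empty.mpr e13) (disjoint_iff_inter_eq_empty.mpr e23) hcl₁ hcl₂ hcl₃
      hone₁ hone₂ hone₃ hT
  · exact three_triangles_stability_three_of_path_nine D hK hk hm T₁ T₂ T₃ h₁ h₂ h₃ e12 e23
      (disjoint_iff_inter_eq_empty.mpr e13) hcl₁ hcl₂ hcl₃ hone₁ hone₂ hone₃ hT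
  · exact three_triangles_stability_three_of_path_nine D hK hk hm T₂ T₁ T₃ h₂ h₁ h₃
      (by rw [inter_comm]; exact e12) e13 (disjoint_iff_inter_eq_empty.mpr e23) hcl₂ hcl₁ hcl₃
      hone₂ hone₁ hone₃
      (fun x' y' z' h1 h2 h3 => by
        rcases hT x' y' z' h1 h2 h3 with h | h | h
        · exact Or.inr (Or.inl h)
        · exact Or.inl h
        · exact Or.inr (Or.inr h))
  · obtain ⟨htt', htt''⟩ := shared_eq_of_three D hK h₁ hcl₁ hcl₂ hcl₃ e12 e13 e23
    subst htt'
    subst htt''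
    exact three_triangles_stability_three_of_windmill D hK (by omega) hm' T₁ T₂ T₃ h₁ h₂ h₃ e12 e13 e23
      hcl₁ hcl₂ hcl₃ hone₁ hone₂ hone₃ hT

end C047

end TriangleCap

end PercRepro
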